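import Summits.ResolutionOfSingularities.ResolutionOfSingularities.Theorems.PurelyInseparableDim4ResConeLossFreeTail
import Summits.ResolutionOfSingularities.ResolutionOfSingularities.Theorems.PurelyInseparableDim4Equimultiple
import HarnessLib
import HarnessLib.Audit.Tags

/-!
# Purely inseparable four-folds — THE ABSTRACT PAIR-CONFINED VIRTUAL CHAIN FOR EVERY PRIME `p` AND EVERY SHADE `d`: from ANY
# step-invariant producing pair charts, a witnessed isolated above-floor pair-confined passive-free chain of constant shade `d`
# and `e_G ≡ 2` (K2(p) lane, SLICE C, general-`p` re-presentation technology; file-holder res-dim4-p-5 g5)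

[OURS · counted 0 · cell `res-dim4-pi` · K2(p) lane, slice C (general-`p` programme after K2(5): res-dim4-typ-1 g4's
`pair_virtual_step (p)` announced 2026-08-29 08:08Z; bus plan res-dim4-p-5 g5 08:09Z) · seat p-5 g5.]  Nothing here proves K2(p)
for any `p`, `NoIsolatedTrap p p` or resolution of singularities in dimension ≥ 4 / char. `p` — NOT proved; every theorem is
CONDITIONAL on an abstract one-step hypothesis `hvstep`.  AI kernel work, weaker than expert review.

This is `…ResConeDInfVirtualChain` (p708093) with `5 ↦ p` and `4 ↦ d`: the `Nat.rec` + `Classical.epsilon` assembly of a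
virtual chain from an ARBITRARY invariant `Inv : ℕ → State K → Prop`, done once for every prime `p` and every shade `d`:
* **`pair_virtual_chain (p)`** — from `Inv 0 B₀`, a SHAPE clause (`Inv t B` ⇒ `B` isolated, `ord₀ B.F = |B.r| + d` with
  `p < |B.r| + d`, `e_G(B) = 2`, `B.r` supported on `{a, a′}`, `x^{B.r} ∣ B.F`) and a STEP clause (`Inv t B` ⇒ some chart
  `ℓ ∈ {a, a′}` and translation `β` with `β ℓ = 0` give `Inv (t+1) (step p univ ℓ β B)`), a chain `c′` with `c′ 0 = B₀`,
  `Inv t (c′ t)` for all `t`, witnessed by pair charts `j′ t ∈ {a, a′}` and translations `b′ t` with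
  `c′ (t+1) = step p univ (j′ t) (b′ t) (c′ t)`, which is an isolated above-floor `Step0 p` chain with `x^{r₀} ∣ F₀`, constant
  shade `d`, `e_G ≡ 2`, and the other two letters never boundary;
* **`pair_representation_of_virtual_chain (p)`** — the same packaged as an ∃-statement (`k₀′ = 0`).
The KILL is the consumer's: loss-free virtual chains die by res-dim4-p-5 g3's C13 `no_lossfree_tail p` (every `p`, `d < p`);
at `(5,4)` every pair-confined passive-free chain dies by `no_pair_tail_four_five`.
[cite: CossartJannsenSaito2020, Thm. 3.14] [cite: Hauser2010, §§F–G (chart expressions of a point blowup; cleaning)]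
bears_on: LADDER-RESOLUTION:D157-DOOR2 (res-dim4-pi · K2(p) = `RidgeBudget.NoAboveFloorTrap p p` · slice C, general-`p` pair-confined re-presentation).
Supports stmt-ResolutionOfSingularities-16155 (helper).
-/

set_option linter.dupNamespace false -- mandated namespace of this single-conjunct summit

noncomputable section

namespace Summit.ResolutionOfSingularities.ResolutionOfSingularities.Theorems.PIDim4

namespace ResCone

open MvPolynomial Finset
open Literature.AlgebraicGeometry.Resolution
open Literature.AlgebraicGeometry.Resolution.CentreBlowup
open Literature.AlgebraicGeometry.Resolution.Hauser2010
open Literature.AlgebraicGeometry.Resolution.HauserPerlega2019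

variable {K : Type} [Field K] [DecidableEq K] (p : ℕ)

/-- **THE ABSTRACT PAIR-CONFINED VIRTUAL CHAIN, every prime `p`, every shade `d`.**  Let `Inv : ℕ → State K → Prop` be any
predicate (virtual time, virtual state) such that (SHAPE) every `Inv`-state is isolated, has `ord₀ F = |r| + d > p`, `e_G = 2`,
boundary letters in `{a, a′}` and `x^r ∣ F`; and (STEP) from every `Inv t B` some point step charted in the pair, `ℓ ∈ {a, a′}`,
`β ℓ = 0`, leads to `Inv (t+1) (step p univ ℓ β B)`.  Then from any `Inv 0 B₀` there is a chain `c′` with `c′ 0 = B₀`,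
`Inv t (c′ t)`, witnessed by pair charts (`c′ (t+1) = step p univ (j′ t) (b′ t) (c′ t)`, `j′ t ∈ {a, a′}`, `b′ t (j′ t) = 0`),
which is an isolated above-floor `Step0 p` chain with `x^{r₀} ∣ F₀`, constant shade `d`, `e_G ≡ 2`, and the other two letters
never boundary. (`Nat.rec` + `Classical.epsilon`.) [OURS · conditional on `hvstep`]
[cite: CossartJannsenSaito2020, Thm. 3.14] [cite: Hauser2010, §§F–G (chart expressions of a point blowup; cleaning)] -/
theorem pair_virtual_chain {d : ℕ} {Inv : ℕ → State K → Prop} {a a' : Fin 4} {B₀ : State K} (hentry : Inv 0 B₀)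
    (hshape : ∀ t B, Inv t B → IsIsolated p B.F ∧ ordZero B.F = ((B.r.degree + d : ℕ) : ℕ∞) ∧ p < B.r.degree + d ∧
      Module.finrank K (resVertex B) = 2 ∧ (∀ i, i ≠ a → i ≠ a' → B.r i = 0) ∧ (∀ e ∈ B.F.support, B.r ≤ e))
    (hvstep : ∀ t B, Inv t B → ∃ (ℓ : Fin 4) (β : Fin 4 → K), (ℓ = a ∨ ℓ = a') ∧ β ℓ = 0 ∧
      Inv (t + 1) (CentreBlowup.step p Finset.univ ℓ β B)) :
    ∃ (c' : ℕ → State K) (j' : ℕ → Fin 4) (b' : ℕ → Fin 4 → K), c' 0 = B₀ ∧ (∀ t, Inv t (c' t)) ∧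
      (∀ t, IsIsolated p (c' t).F ∧ Step0 p (c' t) (c' (t + 1))) ∧ FreeTail.IsWitnessedChain p c' j' b' ∧
      (∀ e ∈ (c' 0).F.support, (c' 0).r ≤ e) ∧ (∀ t, ordZero (c' t).F ≠ p) ∧
      (∀ t, 0 ≤ t → (c' t).shade = (d : ℕ∞)) ∧ (∀ t, 0 ≤ t → Module.finrank K (resVertex (c' t)) = 2) ∧
      (∀ t, 0 ≤ t → (j' t = a ∨ j' t = a')) ∧ (∀ t, 0 ≤ t → ∀ i, i ≠ a → i ≠ a' → (c' t).r i = 0) := by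
  -- (1) the step predicate and the recursion
  obtain ⟨Q, hQ⟩ : ∃ Q : ℕ → State K → Fin 4 × (Fin 4 → K) → Prop,
      ∀ t B x, Q t B x ↔ ((x.1 = a ∨ x.1 = a') ∧ x.2 x.1 = 0 ∧ Inv (t + 1) (CentreBlowup.step p Finset.univ x.1 x.2 B)) :=
    ⟨_, fun _ _ _ => Iff.rfl⟩
  obtain ⟨sq, hd0, hds⟩ : ∃ sq : ℕ → State K, sq 0 = B₀ ∧
      ∀ t, sq (t + 1) = CentreBlowup.step p Finset.univ (Classical.epsilon (Q t (sq t))).1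
        (Classical.epsilon (Q t (sq t))).2 (sq t) :=
    ⟨fun t => Nat.rec B₀ (fun t dt => CentreBlowup.step p Finset.univ (Classical.epsilon (Q t dt)).1
      (Classical.epsilon (Q t dt)).2 dt) t, rfl, fun _ => rfl⟩
  -- (2) the invariant along the recursion
  have hINV : ∀ t, Inv t (sq t) := by
    intro t
    induction t with
    | zero => rw [hd0]; exact hentry
    | succ t ih =>
      have hex : ∃ x, Q t (sq t) x := by
        obtain ⟨ℓ, β, hℓ, hβ, h⟩ := hvstep t (sq t) ih
        exact ⟨(ℓ, β), (hQ t (sq t) (ℓ, β)).mpr ⟨hℓ, hβ, h⟩⟩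
      obtain ⟨-, -, h⟩ := (hQ t (sq t) _).mp (Classical.epsilon_spec hex)
      rw [hds t]
      exact h
  have hspec : ∀ t, Q t (sq t) (Classical.epsilon (Q t (sq t))) := fun t => by
    have hex : ∃ x, Q t (sq t) x := by
      obtain ⟨ℓ, β, hℓ, hβ, h⟩ := hvstep t (sq t) (hINV t)
      exact ⟨(ℓ, β), (hQ t (sq t) (ℓ, β)).mpr ⟨hℓ, hβ, h⟩⟩
    exact Classical.epsilon_spec hex
  -- (3) the packaging
  have hℓ : ∀ t, (Classical.epsilon (Q t (sq t))).1 = a ∨ (Classical.epsilon (Q t (sq t))).1 = a' := fun t =>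
    ((hQ t (sq t) _).mp (hspec t)).1
  have hβℓ : ∀ t, (Classical.epsilon (Q t (sq t))).2 (Classical.epsilon (Q t (sq t))).1 = 0 := fun t =>
    ((hQ t (sq t) _).mp (hspec t)).2.1
  have hisoV : ∀ t, IsIsolated p (sq t).F := fun t => (hshape t (sq t) (hINV t)).1
  have hoV : ∀ t, ordZero (sq t).F = (((sq t).r.degree + d : ℕ) : ℕ∞) := fun t => (hshape t (sq t) (hINV t)).2.1
  have hpV : ∀ t, p < (sq t).r.degree + d := fun t => (hshape t (sq t) (hINV t)).2.2.1
  have heV : ∀ t, Module.finrank K (resVertex (sq t)) = 2 := fun t => (hshape t (sq t) (hINV t)).2.2.2.1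
  have hpassV : ∀ t, ∀ i, i ≠ a → i ≠ a' → (sq t).r i = 0 := fun t => (hshape t (sq t) (hINV t)).2.2.2.2.1
  have hdivV : ∀ t, ∀ e ∈ (sq t).F.support, (sq t).r ≤ e := fun t => (hshape t (sq t) (hINV t)).2.2.2.2.2
  have hple : ∀ t, ((p : ℕ) : ℕ∞) ≤ ordAlong Finset.univ (sq t).F := fun t => by
    rw [ordAlong_univ, hoV t]
    exact_mod_cast (hpV t).le
  have hequi : ∀ t, IsEquimultiplePoint p Finset.univ (Classical.epsilon (Q t (sq t))).1 (Classical.epsilon (Q t (sq t))).2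
      (sq t) := fun t => by
    rw [Equimultiple.isEquimultiplePoint_iff_le_ordZero_step, ← hds t, hoV (t + 1)]
    exact_mod_cast (hpV (t + 1)).le
  have hne : ∀ t, (CentreBlowup.step p Finset.univ (Classical.epsilon (Q t (sq t))).1 (Classical.epsilon (Q t (sq t))).2
      (sq t)).F ≠ 0 := fun t h0 => by
    have h := hoV (t + 1)
    rw [hds t, h0, ordZero_zero] at h
    exact ENat.top_ne_coe _ h
  have hfloorV : ∀ t, ordZero (sq t).F ≠ p := fun t h => by
    rw [hoV t] at h
    have := hpV t
    have h' : (sq t).r.degree + d = p := by exact_mod_cast h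
    omega
  have hshadeV : ∀ t, (sq t).shade = (d : ℕ∞) := fun t => by
    rw [BandShade.shade_eq_coe (hoV t)]
    congr 1
    omega
  refine ⟨sq, fun t => (Classical.epsilon (Q t (sq t))).1, fun t => (Classical.epsilon (Q t (sq t))).2, hd0, hINV,
    fun t => ⟨hisoV t, hple t, (Classical.epsilon (Q t (sq t))).1, (Classical.epsilon (Q t (sq t))).2, Finset.mem_univ _,
      hβℓ t, hequi t, hne t, hds t⟩,
    fun t => ⟨hple t, hβℓ t, hequi t, hne t, hds t⟩, ?_, hfloorV, fun t _ => hshadeV t, fun t _ => heV t,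
    fun t _ => hℓ t, fun t _ => hpassV t⟩
  rw [hd0]
  have := hdivV 0
  rwa [hd0] at this

/-- **THE PAIR-CONFINED RE-PRESENTATION FROM A VIRTUAL CHAIN, every prime `p`, every shade `d`**: under the hypotheses of
`pair_virtual_chain`, there is a witnessed isolated above-floor `Step0 p` chain with `x^{r₀} ∣ F₀`, constant shade `d`,
`e_G ≡ 2`, chart letters in the pair `{a, a′}` and the other two letters never boundary (`k₀′ = 0`).
[OURS · conditional on `hvstep`] [cite: CossartJannsenSaito2020, Thm. 3.14] -/
theorem pair_representation_of_virtual_chain {d : ℕ} {Inv : ℕ → State K → Prop} {a a' : Fin 4} (haa' : a ≠ a')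
    {B₀ : State K} (hentry : Inv 0 B₀)
    (hshape : ∀ t B, Inv t B → IsIsolated p B.F ∧ ordZero B.F = ((B.r.degree + d : ℕ) : ℕ∞) ∧ p < B.r.degree + d ∧
      Module.finrank K (resVertex B) = 2 ∧ (∀ i, i ≠ a → i ≠ a' → B.r i = 0) ∧ (∀ e ∈ B.F.support, B.r ≤ e))
    (hvstep : ∀ t B, Inv t B → ∃ (ℓ : Fin 4) (β : Fin 4 → K), (ℓ = a ∨ ℓ = a') ∧ β ℓ = 0 ∧
      Inv (t + 1) (CentreBlowup.step p Finset.univ ℓ β B)) :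
    ∃ (c' : ℕ → State K) (j' : ℕ → Fin 4) (b' : ℕ → Fin 4 → K) (k₀' : ℕ) (a a' : Fin 4),
      (∀ k, IsIsolated p (c' k).F ∧ Step0 p (c' k) (c' (k + 1))) ∧ FreeTail.IsWitnessedChain p c' j' b' ∧
      (∀ e ∈ (c' 0).F.support, (c' 0).r ≤ e) ∧ (∀ k, ordZero (c' k).F ≠ p) ∧
      (∀ k, k₀' ≤ k → (c' k).shade = (d : ℕ∞)) ∧
      (∀ k, k₀' ≤ k → Module.finrank K (resVertex (c' k)) = 2) ∧ a ≠ a' ∧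
      (∀ k, k₀' ≤ k → (j' k = a ∨ j' k = a')) ∧
      (∀ k, k₀' ≤ k → ∀ i, i ≠ a → i ≠ a' → (c' k).r i = 0) := by
  obtain ⟨c', j', b', -, -, hc', hw', hr0', hfloor', hshade', he', hletters', hpass'⟩ :=
    pair_virtual_chain p hentry hshape hvstep
  exact ⟨c', j', b', 0, a, a', hc', hw', hr0', hfloor', hshade', he', haa', hletters', hpass'⟩

end ResCone

end Summit.ResolutionOfSingularities.ResolutionOfSingularities.Theorems.PIDim4

end
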